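import Summits.Ventures.HodgeRepro.Night1BalancedSets

/-!
# Divisorial ⊕ exceptional: the joint `(k, k)`-eigenspace of a CM product splits canonically into the
`k`-fold products of divisor classes and the span of the exceptional coordinate Hodge classes, and the
Weil space of a non-pairable balanced family lies in the exceptional summand

Blind re-derivation cell `pub-hodge-repro`, seat `night-1` (gen 5, sixteenth file).  Imports night-1's
`Night1BalancedSets` (the balanced and exceptional `2k`-sets, their enumerations, `IsUnionOfBalancedPairs`,
`divisorPowerIn_le_jointEigenspaceOn`) and typer-2's `jointEigenspaceOn_eq_span` (the joint eigenspace is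
spanned by the balanced coordinate wedges).

For any family `Ψ : Γ → Finset X` of cocharacters on a finite set and any `k`:

* `exceptionalWedge S` — the coordinate wedge of an exceptional set (through `exceptionalEnum`);
  `exceptionalPart Ψ k` — their span;
* `exceptionalPart_le_jointEigenspaceOn`, **`jointEigenspaceOn_eq_sup`** — `J = D^k ⊔ E^k`: every balanced
  wedge is a product of divisor classes or an exceptional wedge up to sign;
* **`divisorPowerIn_inf_exceptionalPart_eq_bot`** — `D^k ⊓ E^k = 0`: the exceptional wedges are separated
  by their dual functionals (`coordDual_exceptionalEnum_exceptionalWedge`), each of which kills `D^k` (the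
  criterion);
* **`weilSpaceProd_le_exceptionalPart`** — for a balanced (`SumP k`) family without a complementary pairing
  the Weil space lies in `E^k` (so, with `Night1ProductWeilMatching`, for every sealed face and the
  level-3 classes).

Reading (paper-level, NIGHT1.md §12): the Hodge classes of a CM product carried by coordinate wedges
decompose canonically into the part generated by divisors and an exceptional part, and the Weil classes
of the frontier (every sealed face, the level-3 classes) are exceptional.  Nothing geometric is built;
nothing here says anything about the status of the Hodge conjecture for CM abelian varieties, which is
NOT proved.
-/

set_option autoImplicit false

open Finset Module
open scoped Pointwise

namespace HodgeRepro.RouteC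

open CMHodgeOn

section Decomposition

variable {X : Type*} [Fintype X] [DecidableEq X] {Γ : Type*}

/-! ### The exceptional part -/

omit [Fintype X] in
/-- The enumeration of an exceptional set. -/
noncomputable def exceptionalEnum (Ψ : Γ → Finset X) (k : ℕ) (S : exceptionalSets Ψ k) : Fin (2 * k) → X :=
  enumSet k S.1 S.2.1.1

omit [Fintype X] in
/-- The enumeration of an exceptional set is injective. -/
theorem exceptionalEnum_injective (Ψ : Γ → Finset X) (k : ℕ) (S : exceptionalSets Ψ k) :
    Function.Injective (exceptionalEnum Ψ k S) :=
  enumSet_injective k S.1 S.2.1.1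

omit [Fintype X] in
/-- Its range is the set. -/
theorem range_exceptionalEnum (Ψ : Γ → Finset X) (k : ℕ) (S : exceptionalSets Ψ k) :
    Set.range (exceptionalEnum Ψ k S) = ↑(S : Finset X) :=
  range_enumSet k S.1 S.2.1.1

omit [Fintype X] in
/-- Its image is the set. -/
theorem image_exceptionalEnum (Ψ : Γ → Finset X) (k : ℕ) (S : exceptionalSets Ψ k) :
    univ.image (exceptionalEnum Ψ k S) = (S : Finset X) :=
  image_enumSet k S.1 S.2.1.1

/-- The exceptional wedge of an exceptional set. -/
noncomputable def exceptionalWedge (Ψ : Γ → Finset X) (k : ℕ) (S : exceptionalSets Ψ k) :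
    ⋀[ℂ]^(2 * k) (X → ℂ) :=
  coordWedgeOn (2 * k) (exceptionalEnum Ψ k S)

/-- **The exceptional part**: the span of the exceptional wedges. -/
noncomputable def exceptionalPart (Ψ : Γ → Finset X) (k : ℕ) : Submodule ℂ (⋀[ℂ]^(2 * k) (X → ℂ)) :=
  Submodule.span ℂ (Set.range (exceptionalWedge Ψ k))

omit [Fintype X] in
/-- An exceptional wedge is a balanced wedge. -/
theorem exceptionalWedge_mem_balancedWedgesOn (Ψ : Γ → Finset X) (k : ℕ) (S : exceptionalSets Ψ k) :
    exceptionalWedge Ψ k S ∈ balancedWedgesOn Ψ k := by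
  refine ⟨_, exceptionalEnum_injective Ψ k S, fun γ => ?_, rfl⟩
  rw [image_exceptionalEnum]
  exact S.2.1.2 γ

/-- The exceptional part consists of joint `(k, k)`-classes. -/
theorem exceptionalPart_le_jointEigenspaceOn (Ψ : Γ → Finset X) (k : ℕ) :
    exceptionalPart Ψ k ≤ jointEigenspaceOn Ψ (2 * k) k := by
  rw [exceptionalPart, jointEigenspaceOn_eq_span, Submodule.span_le]
  rintro _ ⟨S, rfl⟩
  exact Submodule.subset_span (exceptionalWedge_mem_balancedWedgesOn Ψ k S)

/-- **Divisorial ⊕ exceptional, the span**: `J = D^k ⊔ E^k`. -/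
theorem jointEigenspaceOn_eq_sup (Ψ : Γ → Finset X) (k : ℕ) :
    jointEigenspaceOn Ψ (2 * k) k = divisorPowerIn Ψ k ⊔ exceptionalPart Ψ k := by
  refine le_antisymm ?_ (sup_le (divisorPowerIn_le_jointEigenspaceOn Ψ k)
    (exceptionalPart_le_jointEigenspaceOn Ψ k))
  rw [jointEigenspaceOn_eq_span, Submodule.span_le]
  rintro _ ⟨s, hs, hbal, rfl⟩
  by_cases hU : IsUnionOfBalancedPairs Ψ k (univ.image s)
  · exact Submodule.mem_sup_left ((isUnionOfBalancedPairs_image_iff Ψ hs).1 hU)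
  · refine Submodule.mem_sup_right ?_
    have hmem : univ.image s ∈ exceptionalSets Ψ k :=
      ⟨⟨by rw [card_image_of_injective _ hs, card_univ, Fintype.card_fin], hbal⟩, hU⟩
    have hsub : ({exceptionalWedge Ψ k ⟨_, hmem⟩} : Set (⋀[ℂ]^(2 * k) (X → ℂ))) ⊆
        Set.range (exceptionalWedge Ψ k) :=
      Set.singleton_subset_iff.2 ⟨⟨_, hmem⟩, rfl⟩
    refine Submodule.span_mono hsub ?_
    refine coordWedgeOn_mem_span_of_range_eq hs ?_
    rw [range_exceptionalEnum, coe_image, coe_univ, Set.image_univ]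

omit [Fintype X] in
/-- The dual functional of an exceptional set picks out its own wedge: `⟨e^*_T, e_S⟩ = [S = T]`. -/
theorem coordDual_exceptionalEnum_exceptionalWedge (Ψ : Γ → Finset X) (k : ℕ)
    (S T : exceptionalSets Ψ k) :
    coordDual (exceptionalEnum Ψ k T) (exceptionalWedge Ψ k S) = if S = T then 1 else 0 := by
  split_ifs with h
  · subst h
    exact coordDual_coordWedgeOn_self (exceptionalEnum_injective Ψ k S)
  · have hne : (S : Finset X) ≠ T := fun h' => h (Subtype.ext h')
    -- some point of `T` is not in `S`
    have hcard : (S : Finset X).card = (T : Finset X).card := by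
      rw [card_of_mem_balancedSets (mem_balancedSets_of_mem_exceptionalSets S.2),
        card_of_mem_balancedSets (mem_balancedSets_of_mem_exceptionalSets T.2)]
    obtain ⟨x, hxT, hxS⟩ : ∃ x ∈ (T : Finset X), x ∉ (S : Finset X) := by
      by_contra hcon
      push Not at hcon
      exact hne (Finset.eq_of_subset_of_card_le (fun x hx => hcon x hx) hcard.le).symm
    have hxrange : x ∈ Set.range (exceptionalEnum Ψ k T) := by
      rw [range_exceptionalEnum]
      exact hxT
    obtain ⟨a, ha⟩ := hxrange
    refine coordDual_coordWedgeOn_eq_zero_of_notMem_range _ (a := a) ?_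
    rw [ha, range_exceptionalEnum]
    exact hxS

/-- **`D^k ⊓ E^k = 0`**: an element of the exceptional part is determined by its coefficients on the
exceptional wedges, and every exceptional dual functional kills `D^k`. -/
theorem divisorPowerIn_inf_exceptionalPart_eq_bot (Ψ : Γ → Finset X) (k : ℕ) :
    divisorPowerIn Ψ k ⊓ exceptionalPart Ψ k = ⊥ := by
  rw [Submodule.eq_bot_iff]
  rintro ω ⟨hD, hE⟩
  rw [exceptionalPart] at hE
  obtain ⟨c, rfl⟩ := Finsupp.mem_span_range_iff_exists_finsupp.1 hE
  have hc : ∀ T : exceptionalSets Ψ k, c T = 0 := by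
    intro T
    -- the `T`-coefficient is the value of the `T`-dual on `ω`
    have h1 : coordDual (exceptionalEnum Ψ k T) (c.sum fun S a => a • exceptionalWedge Ψ k S) =
        c T := by
      rw [map_finsuppSum, Finsupp.sum_eq_single T]
      · rw [map_smul, coordDual_exceptionalEnum_exceptionalWedge, if_pos rfl, smul_eq_mul, mul_one]
      · intro S _ hS
        rw [map_smul, coordDual_exceptionalEnum_exceptionalWedge, if_neg hS, smul_zero]
      · intro _
        rw [zero_smul, map_zero]
    -- and the `T`-dual kills `D^k` since `T` is not a union of balanced pairs
    have h2 : coordDual (exceptionalEnum Ψ k T) (c.sum fun S a => a • exceptionalWedge Ψ k S) =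
        0 := by
      by_contra hne
      obtain ⟨s, hs, hrange⟩ :=
        exists_isBalancedPairing_of_coordDual_ne_zero Ψ (exceptionalEnum_injective Ψ k T) hD hne
      refine not_isUnionOfBalancedPairs_of_mem_exceptionalSets T.2
        ⟨s, hs, concatPairs_injective_of_range_eq (exceptionalEnum_injective Ψ k T) hrange, ?_⟩
      rw [← coe_inj, coe_image, coe_univ, Set.image_univ, hrange, range_exceptionalEnum]
    rw [← h1, h2]
  have hzero : c = 0 := Finsupp.ext hc
  rw [hzero, Finsupp.sum_zero_index]

/-! ### The Weil space of a non-pairable balanced family is exceptional -/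

end Decomposition

section Weil

variable {G : Type*} [Group G] [DecidableEq G] [Fintype G] {ι : Type*} [Fintype ι] [DecidableEq ι]

/-- **The Weil space of a balanced family without a complementary pairing lies in the exceptional
part**: every `σ`-line is an exceptional wedge up to sign. -/
theorem weilSpaceProd_le_exceptionalPart {k : ℕ} (e : Fin (2 * k) ≃ ι)
    {T : ι → Finset G} (hsum : SumP k T) (hnp : ¬ HasComplPairing k T) :
    weilSpaceProd G k e ≤ exceptionalPart (fun g : G => prodTypeSet fun i => g • T i) k := by
  rw [weilSpaceProd, Submodule.span_le]
  rintro _ ⟨σ, rfl⟩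
  show weilWedgeProd e σ ∈ exceptionalPart (fun g : G => prodTypeSet fun i => g • T i) k
  -- the line set is balanced and not a union of balanced pairs
  have hbal : ∀ g : G, (univ.image (lineEnum e σ) ∩ prodTypeSet fun i => g • T i).card = k := by
    intro g
    rw [← cornerCountOn_eq_card_inter _ (lineEnum_injective e σ), cornerCountOn_prodTypeSet_lineEnum,
      card_filter_mem_smul_eq]
    exact hsum _
  have hnotU : ¬ IsUnionOfBalancedPairs (fun g : G => prodTypeSet fun i => g • T i) k
      (univ.image (lineEnum e σ)) := by
    intro hU
    rw [isUnionOfBalancedPairs_image_iff _ (lineEnum_injective e σ)] at hU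
    have h0 : lineDual e σ (weilWedgeProd e σ) = 0 :=
      lineDual_eq_zero_of_mem_divisorPowerIn_of_not_hasComplPairing e T hnp σ hU
    rw [lineDual_weilWedgeProd_self] at h0
    exact one_ne_zero h0
  have hmem : univ.image (lineEnum e σ) ∈
      exceptionalSets (fun g : G => prodTypeSet fun i => g • T i) k :=
    ⟨⟨by rw [card_image_of_injective _ (lineEnum_injective e σ), card_univ, Fintype.card_fin], hbal⟩,
      hnotU⟩
  have hsub : ({exceptionalWedge (fun g : G => prodTypeSet fun i => g • T i) k ⟨_, hmem⟩} :
      Set (⋀[ℂ]^(2 * k) ((ι × G) → ℂ))) ⊆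
        Set.range (exceptionalWedge (fun g : G => prodTypeSet fun i => g • T i) k) :=
    Set.singleton_subset_iff.2 ⟨⟨_, hmem⟩, rfl⟩
  refine Submodule.span_mono hsub ?_
  refine coordWedgeOn_mem_span_of_range_eq (lineEnum_injective e σ) ?_
  rw [range_exceptionalEnum, coe_image, coe_univ, Set.image_univ]

end Weil

end HodgeRepro.RouteC
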